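import Literature.AlgebraicGeometry.ModuliOfAbelianVarieties.SiegelModuliUniversalFamilyQuasiProjective
import Literature.AlgebraicGeometry.AbelianSchemes.PolarizedAbelianSchemeWithLevelBaseChange
import Literature.AlgebraicGeometry.Morphisms.QuasiProjectiveComposition
import Literature.AlgebraicGeometry.Morphisms.ProjectiveOfMonoIntoProjectiveSpace
import Literature.AlgebraicGeometry.HodgeTheory.QuasiProjectiveSeparatedOfField
import HarnessLib

/-!
# The universal abelian scheme over a quasi-projective fine Siegel moduli scheme is PROJECTIVE over it, and so are its
# pull-backs ([MumfordFogartyKirwan1994] Ch. 7 §3 Thm. 7.9 ∕ 7.10; [Hartshorne1977] II §4; [StacksProject] Tag 04XV)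

Topic `AlgebraicGeometry/ModuliOfAbelianVarieties`; namespace `Literature.AlgebraicGeometry.ModuliOfAbelianVarieties.SiegelFineModuliScheme`
(§1–§2 are dot-notation extensions of ★ `Morphisms.IsProjective` ∕ ★ `AbelianSchemes.AbelianSchemeOver`, declared with absolute names).
THEOREMS ONLY (no definition, no named fact, no instance, no notation, no `sorry`).  Cell `hodgecm-mathlib` (D-0151), FLOOR 0, P6 «MOD»
(crux hLiu418 = stmt-HodgeConjecture-24832, `--supports`), the JUNCTION INPUT `IsProjective P.A.X.hom` of the (γ′) road for the E-sheet socket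
(`P := 𝓜.univ.baseChange (ε ≫ pr)` over `X = (M_K) ⊗_L Fᵢ`; it is the `hproj` binder of ★ (M1) `SerreTensorDualPairOfProjective`
`exists_serreTensor_dualPair_unit` and of ★ `SerreTensorProjective.isProjective_serreTensor_hom`).  HC_CM is proved only modulo the printed
citations (2 remaining named inputs hLiu418 24832, h413 24833) until rung 0 closes; this file is generic and changes no count.

THE MATHEMATICS.  (§1) Let `f : X → Y` be proper and `g : Y → S` any morphism with `f ≫ g` quasi-projective (Hartshorne) and quasi-compact.
Then `X` admits a quasi-compact immersion `i : X ↪ 𝐏(ι; S)` over `S` (★ `IsQuasiProjective.exists_immersion_projectiveSpace`); its lift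
`j = (f, i) : X → 𝐏(ι; Y) = Y ×_S 𝐏(ι; S)` (★ `isPullback_projectiveSpaceMap`) is a monomorphism (`j ≫ pr = i` is one) lying over the proper `f`,
hence a closed immersion ([StacksProject] 04XV, ★ `IsProjective.of_mono_projectiveSpace`): `f` is projective.  (§2) In particular a proper
`f : X → M` into a `k`-scheme whose total space `X → M → Spec k` is quasi-projective over the field `k` is projective, e.g. the structure
morphism of an abelian scheme whose total space is quasi-projective; projectivity is stable under base change (★ `IsProjective.pullback_snd`).
(§3) The universal abelian scheme of a fine Siegel moduli scheme `𝓜` with quasi-projective carrier has quasi-projective total space (★ (F-c″)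
`isQuasiProjectiveOver_univ`, [MumfordFogartyKirwan1994] Thm. 7.9), hence `𝓜.univ.A → 𝓜.M` is projective, and so is every pull-back
`(𝓜.univ.baseChange x).A → T` — the shape the E-sheet consumers take.

* §1 `Morphisms.IsProjective.of_isProper_of_isQuasiProjective_comp` — proper + quasi-projective composite ⇒ projective.
* §2 `Morphisms.IsProjective.of_isProper_of_isQuasiProjectiveOver_total` (over a field), `AbelianSchemeOver.isProjective_hom_of_isQuasiProjectiveOver_total`,
  `AbelianSchemeOver.isProjective_baseChange_hom`.
* §3 **`SiegelFineModuliScheme.isProjective_univ_hom`**, **`SiegelFineModuliScheme.isProjective_univ_baseChange_hom`** — THE HEADS.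

## References
* [MumfordFogartyKirwan1994] D. Mumford, J. Fogarty, F. Kirwan, *Geometric Invariant Theory*, 3rd ed. (1994), Ch. 7 §3 Thm. 7.9 (p. 139), Thm. 7.10.
* [Hartshorne1977] R. Hartshorne, *Algebraic Geometry* (1977), II §4 Definition p. 103, Cor. 4.8 (p. 102), Ex. 4.9.
* [StacksProject] The Stacks Project, Tag 04XV (proper monomorphisms are closed immersions), Tag 01VW, Tag 01NF.
-/

set_option autoImplicit false

noncomputable section

universe u

open CategoryTheory CategoryTheory.Limits AlgebraicGeometry
open Literature.AlgebraicGeometry.Morphisms (IsProjective IsQuasiProjective projectiveSpace projectiveSpaceFst projectiveSpaceMap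
  isPullback_projectiveSpaceMap)
open Literature.AlgebraicGeometry.HodgeTheory (IsQuasiProjectiveOver)
open Literature.AlgebraicGeometry.AbelianSchemes (AbelianSchemeOver PolarizedAbelianSchemeWithLevel)

namespace Literature.AlgebraicGeometry.ModuliOfAbelianVarieties

/-! ### §1 Proper with quasi-projective composite is projective -/

/-- **A proper morphism whose composite with a further morphism is (quasi-compact) quasi-projective is projective** (dot-notation
extension of ★ `Morphisms.IsProjective`, absolute name): if `f : X → Y` is proper and `f ≫ g : X → S` is quasi-projective and
quasi-compact, then `f` is projective — `X ↪ 𝐏(ι; S)` a quasi-compact immersion over `S`, its lift `(f, i) : X → 𝐏(ι; Y) = Y ×_S 𝐏(ι; S)`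
is a monomorphism over the proper `f`, hence a closed immersion. [cite: StacksProject, Tag 04XV] [cite: Hartshorne1977, II §4 Definition p.103 (projective morphism) and Cor. 4.8 (p. 102)] -/
theorem _root_.Literature.AlgebraicGeometry.Morphisms.IsProjective.of_isProper_of_isQuasiProjective_comp
    {X Y S : Scheme.{u}} {f : X ⟶ Y} (g : Y ⟶ S) [IsProper f] (h : IsQuasiProjective (f ≫ g)) [QuasiCompact (f ≫ g)] :
    IsProjective f := by
  obtain ⟨ι, hι, i, hi, -, hif⟩ := h.exists_immersion_projectiveSpace
  haveI := hi
  -- the lift `j = (f, i) : X → 𝐏(ι; Y)` through the cartesian square `𝐏(ι; Y) = Y ×_S 𝐏(ι; S)`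
  have hP := isPullback_projectiveSpaceMap ι g
  have hw : i ≫ projectiveSpaceFst ι S = f ≫ g := hif
  let j : X ⟶ projectiveSpace ι Y := hP.lift i f hw
  have hj₁ : j ≫ projectiveSpaceMap ι g = i := hP.lift_fst i f hw
  have hj₂ : j ≫ projectiveSpaceFst ι Y = f := hP.lift_snd i f hw
  -- `j` is a monomorphism: `j ≫ pr = i` is one (an immersion)
  haveI : Mono (j ≫ projectiveSpaceMap ι g) := by rw [hj₁]; infer_instance
  haveI : Mono j := mono_of_mono j (projectiveSpaceMap ι g)
  exact IsProjective.of_mono_projectiveSpace ι j hj₂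

/-! ### §2 Over a field: proper maps with quasi-projective total space; abelian schemes -/

/-- **A proper morphism into a `k`-scheme whose total space is quasi-projective over the field `k` is projective**: for
`f : X → M` proper with `X → M → Spec k` quasi-projective over `k` (★ `HodgeTheory.IsQuasiProjectiveOver`, an open immersion into a
projective `k`-scheme — automatically quasi-compact), `f` is projective (§1). [cite: Hartshorne1977, II §4 Definition p.103 (projective morphism) and Cor. 4.8 (p. 102)] [cite: StacksProject, Tag 04XV] -/
theorem _root_.Literature.AlgebraicGeometry.Morphisms.IsProjective.of_isProper_of_isQuasiProjectiveOver_total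
    {k : Type u} [Field k] {M : Motives.SchemeOver k} {X : Scheme.{u}} (f : X ⟶ M.left) [IsProper f]
    (h : IsQuasiProjectiveOver (Over.mk (f ≫ M.hom) : Motives.SchemeOver k)) : IsProjective f := by
  haveI : QuasiCompact (f ≫ M.hom) := h.hom_quasiCompact
  exact Morphisms.IsProjective.of_isProper_of_isQuasiProjective_comp M.hom
    (Morphisms.IsQuasiProjective.of_isQuasiProjectiveOver h)

/-- **An abelian scheme over a `k`-scheme whose total space is quasi-projective over `k` is projective over its base** (dot-notation
extension of ★ `AbelianSchemeOver`, absolute name): `A → M` is proper, so §2 applies. [cite: MumfordFogartyKirwan1994, Ch. 7 §3 Theorem 7.9 (p. 139)] [cite: Hartshorne1977, II §4 Definition p.103 (projective morphism)] -/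
theorem _root_.Literature.AlgebraicGeometry.AbelianSchemes.AbelianSchemeOver.isProjective_hom_of_isQuasiProjectiveOver_total
    {k : Type u} [Field k] {M : Motives.SchemeOver k} (A : AbelianSchemeOver M.left)
    (h : IsQuasiProjectiveOver (Over.mk (A.X.hom ≫ M.hom) : Motives.SchemeOver k)) : IsProjective A.X.hom := by
  haveI := A.isProper
  exact Morphisms.IsProjective.of_isProper_of_isQuasiProjectiveOver_total A.X.hom h

/-- **Projectivity of an abelian scheme is stable under base change**: if `A → S` is projective then `A ×_S S′ → S′` is (★
`IsProjective.pullback_snd`; `(A.baseChange g).X.hom = pr₂`). [cite: Hartshorne1977, II Ex. 4.9] -/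
theorem _root_.Literature.AlgebraicGeometry.AbelianSchemes.AbelianSchemeOver.isProjective_baseChange_hom
    {S S' : Scheme.{u}} (A : AbelianSchemeOver S) (h : IsProjective A.X.hom) (g : S' ⟶ S) :
    IsProjective (A.baseChange g).X.hom := by
  change IsProjective (pullback.snd A.X.hom g)
  exact h.pullback_snd g

/-! ### §3 The heads: the universal family of a quasi-projective fine Siegel moduli scheme -/

namespace SiegelFineModuliScheme

variable {g N : ℕ} {δ : Fin g → ℕ} (𝓜 : SiegelFineModuliScheme g N δ)

/-- **The universal abelian scheme of a fine Siegel moduli scheme with quasi-projective carrier is PROJECTIVE over the moduli scheme**: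
its total space is quasi-projective over `ℚ` (★ (F-c″) `isQuasiProjectiveOver_univ`, [MumfordFogartyKirwan1994] Thm. 7.9) and
`𝓜.univ.A → 𝓜.M` is proper (§2). [cite: MumfordFogartyKirwan1994, Ch. 7 §3 Theorem 7.9 (p. 139)] [cite: Hartshorne1977, II §4 Definition p.103 (projective morphism)] -/
theorem isProjective_univ_hom (hδ : IsPolarizationType δ) (hqp : IsQuasiProjectiveOver 𝓜.M) :
    IsProjective 𝓜.univ.A.X.hom :=
  𝓜.univ.A.isProjective_hom_of_isQuasiProjectiveOver_total (𝓜.isQuasiProjectiveOver_univ hδ hqp)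

/-- **Every pull-back of the universal family is projective over its base**: for any `x : T → 𝓜.M` (e.g. `ε ≫ pr : X → 𝓜.M` of the
E-sheet road), `(𝓜.univ.baseChange x).A → T` is projective — the `hproj` input of ★ (M1) `exists_serreTensor_dualPair_unit` ∕ ★
`isProjective_serreTensor_hom` for the Serre tensor of the pulled-back family. [cite: MumfordFogartyKirwan1994, Ch. 7 §3 Theorem 7.9 (p. 139)] [cite: Hartshorne1977, II Ex. 4.9] -/
theorem isProjective_univ_baseChange_hom (hδ : IsPolarizationType δ) (hqp : IsQuasiProjectiveOver 𝓜.M)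
    {T : Scheme.{0}} (x : T ⟶ 𝓜.M.left) : IsProjective (𝓜.univ.baseChange x).A.X.hom :=
  𝓜.univ.A.isProjective_baseChange_hom (𝓜.isProjective_univ_hom hδ hqp) x

end SiegelFineModuliScheme

end Literature.AlgebraicGeometry.ModuliOfAbelianVarieties

end
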